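import Summits.BirchSwinnertonDyer.BirchSwinnertonDyer.Theses.PrintCf2
import Summits.BirchSwinnertonDyer.BirchSwinnertonDyer.Theorems.PrintCf2DisegniPairTwoDisegniGZPair
import HarnessLib

/-!
# Route PrintCf2 — support item `SplitBadTwoDisegniGZPairOfFacts` (stmt-BirchSwinnertonDyer-27325) CLOSED

Cell `bsd-print-cf2` (D-0131 (2) PRINT TIER, leaf CornerF @ `p = 2`), width seat `bsd-line-cf2-p1-w8` g25.
The item is the ENTRY TICKET of road (C) `disegni-pair-two` on the crux `SplitBadTwoRankOneOfFacts`
(stmt-BirchSwinnertonDyer-20368) — the print-conjoined Disegni–Gross–Zagier pair on the three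
`ε_{d*}∘N`-lines `d* ∈ {2, −1, −2}` (= Lines v3.2 `stub_disegniGZ_pair_two`), in the typed-facts TWIN form
of pen g25 (rev 63): antecedents `Disegni2017.thmB_chi_quadraticBaseChange`,
`WeierstrassCurve.exists_isCanonicalCyc`, `WeierstrassCurve.isCanonicalCyc_pairing_eq_minusTwist` (ty2 g50,
statement-only named facts = aside items 27314–27316) and `WeierstrassCurve.hasEntireLFunction_rat`. GRANTED
those four prints, the conclusion is a THEOREM: `PrintCf2.DisegniPairTwo.disegniGZ_pair_two_of_prints`
(`Theorems/PrintCf2DisegniPairTwoDisegniGZPair.lean`), whose type is the item text verbatim; this file is the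
one-line by-name closer. beyond-print theorem: NO (conditional on the four named facts displayed as
antecedents; nothing else). BSD is not proved by any of this; 20368 is NOT closed here.
[cite: Disegni2017, Theorem A, Theorem B (arXiv v3 PDF pp. 6–8), (1.1.3), (4.1.7)]
-/

-- single-conjunct summit: `Summit.BirchSwinnertonDyer.BirchSwinnertonDyer.…` repeats the name by design
set_option linter.dupNamespace false

namespace Summit.BirchSwinnertonDyer.BirchSwinnertonDyer.Theorems

/-- **Item `SplitBadTwoDisegniGZPairOfFacts` (stmt-BirchSwinnertonDyer-27325) holds**: the three typed
facts + modularity ⟹ the Disegni–Gross–Zagier pair on the three `ε_{d*}∘N`-lines, by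
`PrintCf2.DisegniPairTwo.disegniGZ_pair_two_of_prints`.
[cite: Disegni2017, Theorem B (arXiv v3 PDF p. 8 L9–18), (4.1.7)] [cite: MazurSteinTate2006, §2.7–2.8]
[cite: Gross2004, §3, §13] [cite: BreuilConradDiamondTaylor2001, Thm. A] -/
theorem splitBadTwoDisegniGZPairOfFacts_proof :
    Summit.BirchSwinnertonDyer.BirchSwinnertonDyer.Theses.PrintCf2.SplitBadTwoDisegniGZPairOfFacts := by
  unfold Summit.BirchSwinnertonDyer.BirchSwinnertonDyer.Theses.PrintCf2.SplitBadTwoDisegniGZPairOfFacts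
  exact PrintCf2.DisegniPairTwo.disegniGZ_pair_two_of_prints

end Summit.BirchSwinnertonDyer.BirchSwinnertonDyer.Theorems
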